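import Summits.CriticalPhenomena.CardyFormulaZ2.Theorems.CardyRotToConfR2SymmetryUpgrade.Negative.SurgFatFamily
import Summits.CriticalPhenomena.CardyFormulaZ2.Theorems.CardyRotToConfR2SymmetryUpgrade.Negative.SurgConcatHit
import Summits.CriticalPhenomena.CardyFormulaZ2.Theorems.CardyRotToConfR2SymmetryUpgradeFatSurgeryLocalStop
import Literature.Probability.RandomPlanarGeometry.ChordalCurveFamilyProofs
import HarnessLib

/-!
# Classes prefixed by the surgery chord: remaining domain and restarting
# (line `germ-label-transport`, crux `stmt-CriticalPhenomena-0698`, stub `stub_fatSurgeryMarkovPrefix`)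

Four deterministic facts about the prefixing map `π := Negative.firePrefix D`
(`π ξ = concatClass (mk (fireChord D)) ξ`) of a Dobrushin domain `(D; a, b)` with surgery chord
`C := fireChord D` from `a` to its landing point `q := firePt D`, and (when the germ at `a` fires and
`q ≠ b`) crosscut domain `E := fireDom h hq`, the `b`-adjacent component of `D ∖ C` with marks
`(q, b)`. They are used in the Markov property of the fat-germ one-shot surgery
(`Negative.fatSurgery`):

* `remainingDomain_firePrefix` — for a class `p` from `q`,
  `remainingDomain D (π p) = remainingDomain E p` (the other component of `D ∖ C` is not adjacent
  to `b`, and a component of `D ∖ (C ∪ p)` through a point of `E` stays in `E`);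
* `startFrom_concat_of_hitParam_eq_one`, `startFrom_firePrefix_of_forall_lt` — if `C` meets the
  closed set `F` only at `q`, restarting `π ξ` at `F` gives back `ξ`;
* `startFrom_firePrefix_of_forall_notMem` — if `C` misses `F`, `startFrom F (π ξ) = startFrom F ξ`;
* `startFrom_firePrefix_of_hitParam_eq` — if `C` first meets `F` at `sg ∈ (0, 1)`,
  `startFrom F (π ξ) = startFrom {C sg} (π ξ)`;
* `stub_fatSurgeryMarkovPrefix` — the four facts bundled (registered stub).

References: W. Werner, Lectures on two-dimensional critical percolation (2007), §3.2;
M. Aizenman, A. Burchard, Duke Math. J. 99 (1999), §2.1 (curve space).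
-/

noncomputable section

open Set Filter Topology Metric
open scoped unitInterval

namespace Summit.CriticalPhenomena.CardyFormulaZ2.Theorems.CardyRotToConfR2SymmetryUpgrade

open Literature.Probability.RandomPlanarGeometry
open Literature.Probability.RandomPlanarGeometry.BrownianLoop
open Summit.CriticalPhenomena.CardyFormulaZ2.Theorems.CardyRotToConfR2SymmetryUpgrade.Negative

namespace FatSurgeryMarkovPrefix

/-! ### The remaining domain of a prefixed class -/

section Remaining

variable {D : DobrushinDomain} (h : Fires D.carrier (D.pt 0)) (hq : firePt D ≠ D.pt 1)

/-- **Remaining domain of a prefixed class.** For a class `p` from the landing point,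
`remainingDomain D (firePrefix D p) = remainingDomain (fireDom h hq) p`: the unexplored set
`D ∖ (chord ∪ p)` splits along the two (open, disjoint) components of `D ∖ chord`; components
through the other component stay there and are not adjacent to `b`, components through the
`b`-component are the components of `(fireDom h hq) ∖ p`. [folklore] -/
theorem remainingDomain_firePrefix {p : CurveClass ℂ} (hp : p.source = firePt D) :
    remainingDomain D (firePrefix D p) = remainingDomain (fireDom h hq) p := by
  have hL := isCrosscut_fireChord h
  have hcar : (fireDom h hq).carrier = bComponent hL hq := rfl
  have hrange : (firePrefix D p).range = (fireChord D).range ∪ p.range := by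
    rw [range_firePrefix D hp, range_fireChord]
  have hsub : bComponent hL hq \ p.range ⊆ D.carrier \ ((fireChord D).range ∪ p.range) := fun z hz =>
    ⟨(bComponent_subset hL hq hz.1).1, fun hz' => hz'.elim (bComponent_subset hL hq hz.1).2 hz.2⟩
  have hmono : D.carrier \ ((fireChord D).range ∪ p.range) ⊆ D.carrier \ (fireChord D).range :=
    sdiff_subset_sdiff_right subset_union_left
  ext z
  simp only [remainingDomain, mem_setOf_eq, hrange, hcar, pt_one_fireDom]
  constructor
  · rintro ⟨hz, hb⟩
    have hzBW : z ∈ bComponent hL hq ∪ otherComponent hL hq := by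
      rw [union_components]
      exact hmono hz
    rcases hzBW with hzB | hzW
    · refine ⟨⟨hzB, fun hzR => hz.2 (Or.inr hzR)⟩, ?_⟩
      -- the component of `z` in `D ∖ (chord ∪ p)` lies in `bComponent ∖ p`
      have hCsub : connectedComponentIn (D.carrier \ ((fireChord D).range ∪ p.range)) z ⊆
          bComponent hL hq ∪ otherComponent hL hq := by
        rw [union_components]
        exact (connectedComponentIn_subset _ _).trans hmono
      have hCB : connectedComponentIn (D.carrier \ ((fireChord D).range ∪ p.range)) z ⊆
          bComponent hL hq :=
        isPreconnected_connectedComponentIn.subset_left_of_subset_union (isOpen_bComponent hL hq)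
          (isOpen_otherComponent hL hq) (disjoint_components hL hq) hCsub
          ⟨z, mem_connectedComponentIn hz, hzB⟩
      have hCBR : connectedComponentIn (D.carrier \ ((fireChord D).range ∪ p.range)) z ⊆
          bComponent hL hq \ p.range := fun w hw =>
        ⟨hCB hw, fun hwR => (connectedComponentIn_subset _ _ hw).2 (Or.inr hwR)⟩
      exact closure_mono (isPreconnected_connectedComponentIn.subset_connectedComponentIn
        (mem_connectedComponentIn hz) hCBR) hb
    · -- the component of `z` lies in the other component, whose closure misses `b`
      exfalso
      have hCW : connectedComponentIn (D.carrier \ ((fireChord D).range ∪ p.range)) z ⊆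
          otherComponent hL hq := by
        rw [← connectedComponentIn_eq_otherComponent hL hq hzW]
        exact connectedComponentIn_mono z hmono
      exact pt_one_notMem_closure_otherComponent hL hq (closure_mono hCW hb)
  · rintro ⟨hz, hb⟩
    exact ⟨hsub hz, closure_mono (connectedComponentIn_mono z hsub) hb⟩

end Remaining

/-! ### Restarting a prefixed class at a closed set -/

section Restart

variable {a b : C(I, ℂ)} {F : Set ℂ}

/-- **Restarting at a terminal hit of the first piece.** If the first piece meets `F` first at
its endpoint (`hitParam F = 1` and `a 1 ∈ F`), restarting the concatenation at `F` gives back the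
second piece exactly (as parametrised curves). [folklore] -/
theorem startFrom_concat_of_hitParam_eq_one (hab : a 1 = b 0) (h1 : (Curve.mk a).hitParam F = 1)
    (hmem : a 1 ∈ F) : (Curve.mk (concatCM a b)).startFrom F = Curve.mk b := by
  have hsg : (Curve.mk a).hitParam F = (1 : I) := by rw [h1, Set.Icc.coe_one]
  have hT := hitParam_concat_of_hit hab hsg hmem
  refine Curve.ext (ContinuousMap.ext fun s => ?_)
  show (Curve.mk (concatCM a b)).startFrom F s = b s
  rw [Curve.startFrom_apply, hT]
  simp only [Set.Icc.coe_one]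
  have hs1 : (1 : ℝ) / 2 + (1 - 1 / 2) * s ∈ Icc (0 : ℝ) 1 := ⟨by linarith [s.2.1], by linarith [s.2.2]⟩
  rw [projIcc_of_mem _ hs1]
  show concatCM a b ⟨_, hs1⟩ = b s
  have hge : 1 / 2 ≤ ((⟨(1 : ℝ) / 2 + (1 - 1 / 2) * s, hs1⟩ : I) : ℝ) := by
    show (1 : ℝ) / 2 ≤ 1 / 2 + (1 - 1 / 2) * s; linarith [s.2.1]
  rcases hge.eq_or_lt with heq | hlt
  · rw [concatCM_apply_of_eq hab, if_pos heq.symm.le]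
    have h1' : dbl₁ ⟨(1 : ℝ) / 2 + (1 - 1 / 2) * s, hs1⟩ = 1 :=
      Subtype.ext (by rw [coe_dbl₁ heq.symm.le, Set.Icc.coe_one]; simp only at heq ⊢; linarith)
    rw [h1', hab]
    congr 1
    apply Subtype.ext
    simp only [Set.Icc.coe_zero] at heq ⊢
    linarith
  · rw [concatCM_apply_of_eq hab, if_neg (not_le.2 hlt)]
    congr 1
    exact Subtype.ext (by rw [coe_dbl₂ hlt.le]; simp only; ring)

variable {D : DobrushinDomain}

/-- **Restart at the junction.** If the surgery chord meets the closed set `F` only at its landing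
point `q ∈ F`, then for a class `ξ` from `q`, `startFrom F (firePrefix D ξ) = ξ`. [folklore] -/
theorem startFrom_firePrefix_of_forall_lt (hF : IsClosed F)
    (hlt : ∀ t : I, (t : ℝ) < 1 → fireChord D t ∉ F) (hq : firePt D ∈ F) {ξ : CurveClass ℂ}
    (hξ : ξ.source = firePt D) : CurveClass.startFrom F (firePrefix D ξ) = ξ := by
  obtain ⟨ξ₀, rfl⟩ := CurveClass.surjective_mk ξ
  rw [CurveClass.source_mk] at hξ
  have hmem : fireChord D 1 ∈ F := by rw [← Curve.target_def, target_fireChord]; exact hq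
  have h1 : (fireChord D).hitParam F = 1 := by
    have := FatSurgeryLocal.hitParam_eq_of_forall_lt
      (fun t ht => hlt t (by rwa [Set.Icc.coe_one] at ht)) hmem
    rwa [Set.Icc.coe_one] at this
  rw [firePrefix_mk, mkCM, CurveClass.startFrom_mk_holds F hF,
    startFrom_concat_of_hitParam_eq_one (FatSurgeryLocal.fireChord_junction hξ) h1 hmem]

/-- **Restart beyond the chord.** If the surgery chord misses the closed set `F`, then for a class
`ξ` from the landing point, `startFrom F (firePrefix D ξ) = startFrom F ξ`. [folklore] -/
theorem startFrom_firePrefix_of_forall_notMem (hF : IsClosed F) (hFa : ∀ t : I, fireChord D t ∉ F)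
    {ξ : CurveClass ℂ} (hξ : ξ.source = firePt D) :
    CurveClass.startFrom F (firePrefix D ξ) = CurveClass.startFrom F ξ := by
  obtain ⟨ξ₀, rfl⟩ := CurveClass.surjective_mk ξ
  rw [CurveClass.source_mk] at hξ
  rw [firePrefix_mk, mkCM, CurveClass.startFrom_mk_holds F hF, CurveClass.startFrom_mk_holds F hF,
    startFrom_concat_of_forall_notMem (FatSurgeryLocal.fireChord_junction hξ) (fun t => hFa t)]

/-- The chord of a firing domain first meets the singleton `{chord sg}` at `sg`. [folklore] -/
theorem hitParam_fireChord_singleton (h : Fires D.carrier (D.pt 0)) (sg : I) :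
    (fireChord D).hitParam {fireChord D sg} = sg :=
  FatSurgeryLocal.hitParam_eq_of_forall_lt
    (fun _ ht hmem => ht.ne (congrArg Subtype.val (injective_fireChord h (mem_singleton_iff.1 hmem))))
    (mem_singleton _)

/-- **Restart at a mid-chord hit.** If the surgery chord first meets the closed set `F` at the
parameter `sg` (and is in `F` there), then for a class `ξ` from the landing point,
`startFrom F (firePrefix D ξ) = startFrom {fireChord D sg} (firePrefix D ξ)`: both restart the
same representative at the parameter `sg / 2`. [folklore] -/
theorem startFrom_firePrefix_of_hitParam_eq (hF : IsClosed F) (h : Fires D.carrier (D.pt 0))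
    {sg : I} (hsg : (fireChord D).hitParam F = sg) (hmem : fireChord D sg ∈ F) {ξ : CurveClass ℂ}
    (hξ : ξ.source = firePt D) :
    CurveClass.startFrom F (firePrefix D ξ) =
      CurveClass.startFrom {fireChord D sg} (firePrefix D ξ) := by
  obtain ⟨ξ₀, rfl⟩ := CurveClass.surjective_mk ξ
  rw [CurveClass.source_mk] at hξ
  have hab := FatSurgeryLocal.fireChord_junction hξ
  rw [firePrefix_mk, mkCM, CurveClass.startFrom_mk_holds F hF,
    CurveClass.startFrom_mk_holds _ isClosed_singleton]
  congr 1
  apply startFrom_eq_of_hitParam_eq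
  rw [hitParam_concat_of_hit hab hsg hmem,
    hitParam_concat_of_hit hab (hitParam_fireChord_singleton h sg) (mem_singleton _)]

end Restart

end FatSurgeryMarkovPrefix

open FatSurgeryMarkovPrefix in
/-- **Classes prefixed by the surgery chord** (registered stub `stub_fatSurgeryMarkovPrefix` of the
line `germ-label-transport`): (a) the remaining domain of `D` after a prefixed past from the
landing point is the remaining domain of the crosscut domain after the suffix; (b) if the chord
meets the closed set `F` only at its landing point, restarting a prefixed class at `F` returns the
suffix; (c) if the chord misses `F`, restarting commutes past the prefix; (d) if the chord first
meets `F` at `sg ∈ (0, 1)`, restarting at `F` is restarting at the singleton `{chord sg}`.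
[folklore] -/
theorem stub_fatSurgeryMarkovPrefix : (∀ (D : DobrushinDomain) (h : Summit.CriticalPhenomena.CardyFormulaZ2.Theorems.CardyRotToConfR2SymmetryUpgrade.Negative.Fires D.carrier (D.pt 0)) (hq : Summit.CriticalPhenomena.CardyFormulaZ2.Theorems.CardyRotToConfR2SymmetryUpgrade.Negative.firePt D ≠ D.pt 1) (p : CurveClass ℂ), p.source = Summit.CriticalPhenomena.CardyFormulaZ2.Theorems.CardyRotToConfR2SymmetryUpgrade.Negative.firePt D → remainingDomain D (Summit.CriticalPhenomena.CardyFormulaZ2.Theorems.CardyRotToConfR2SymmetryUpgrade.Negative.firePrefix D p) = remainingDomain (Summit.CriticalPhenomena.CardyFormulaZ2.Theorems.CardyRotToConfR2SymmetryUpgrade.Negative.fireDom h hq) p) ∧ (∀ (D : DobrushinDomain) (F : Set ℂ), IsClosed F → Summit.CriticalPhenomena.CardyFormulaZ2.Theorems.CardyRotToConfR2SymmetryUpgrade.Negative.Fires D.carrier (D.pt 0) → (∀ t : unitInterval, (t : ℝ) < 1 → Summit.CriticalPhenomena.CardyFormulaZ2.Theorems.CardyRotToConfR2SymmetryUpgrade.Negative.fireChord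 D t ∉ F) → Summit.CriticalPhenomena.CardyFormulaZ2.Theorems.CardyRotToConfR2SymmetryUpgrade.Negative.firePt D ∈ F → ∀ ξ : CurveClass ℂ, ξ.source = Summit.CriticalPhenomena.CardyFormulaZ2.Theorems.CardyRotToConfR2SymmetryUpgrade.Negative.firePt D → CurveClass.startFrom F (Summit.CriticalPhenomena.CardyFormulaZ2.Theorems.CardyRotToConfR2SymmetryUpgrade.Negative.firePrefix D ξ) = ξ) ∧ (∀ (D : DobrushinDomain) (F : Set ℂ), IsClosed F → (∀ t : unitInterval, Summit.CriticalPhenomena.CardyFormulaZ2.Theorems.CardyRotToConfR2SymmetryUpgrade.Negative.fireChord D t ∉ F) → ∀ ξ : CurveClass ℂ, ξ.source = Summit.CriticalPhenomena.CardyFormulaZ2.Theorems.CardyRotToConfR2SymmetryUpgrade.Negative.firePt D → CurveClass.startFrom F (Summit.CriticalPhenomena.CardyFormulaZ2.Theorems.CardyRotToConfR2SymmetryUpgrade.Negative.firePrefix D ξ) = CurveClass.startFrom F ξ) ∧ (∀ (D : DobrushinDomain) (F : Set ℂ), IsClosed F → Summit.CriticalPhenomena.CardyFormulaZ2.Theorems.CardyRotToConfR2SymmetryUpgrade.Negative.Fires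 D.carrier (D.pt 0) → ∀ sg : unitInterval, 0 < (sg : ℝ) → (sg : ℝ) < 1 → (Summit.CriticalPhenomena.CardyFormulaZ2.Theorems.CardyRotToConfR2SymmetryUpgrade.Negative.fireChord D).hitParam F = sg → Summit.CriticalPhenomena.CardyFormulaZ2.Theorems.CardyRotToConfR2SymmetryUpgrade.Negative.fireChord D sg ∈ F → ∀ ξ : CurveClass ℂ, ξ.source = Summit.CriticalPhenomena.CardyFormulaZ2.Theorems.CardyRotToConfR2SymmetryUpgrade.Negative.firePt D → CurveClass.startFrom F (Summit.CriticalPhenomena.CardyFormulaZ2.Theorems.CardyRotToConfR2SymmetryUpgrade.Negative.firePrefix D ξ) = CurveClass.startFrom {Summit.CriticalPhenomena.CardyFormulaZ2.Theorems.CardyRotToConfR2SymmetryUpgrade.Negative.fireChord D sg} (Summit.CriticalPhenomena.CardyFormulaZ2.Theorems.CardyRotToConfR2SymmetryUpgrade.Negative.firePrefix D ξ)) :=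
  ⟨fun _ h hq _ hp => remainingDomain_firePrefix h hq hp,
    fun _ _ hF _ hlt hq _ hξ => startFrom_firePrefix_of_forall_lt hF hlt hq hξ,
    fun _ _ hF hFa _ hξ => startFrom_firePrefix_of_forall_notMem hF hFa hξ,
    fun _ _ hF h _ _ _ hsg hmem _ hξ => startFrom_firePrefix_of_hitParam_eq hF h hsg hmem hξ⟩

end Summit.CriticalPhenomena.CardyFormulaZ2.Theorems.CardyRotToConfR2SymmetryUpgrade

end
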